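import Literature.MathematicalPhysics.QuantumFieldTheory.Balaban1983to89.B6MultiLevelTorusMirrorImageFold
import Literature.MathematicalPhysics.QuantumFieldTheory.Balaban1983to89.B4Eq242SignedImagesFold

/-!
# `Balaban1983to89.B4Eq242TorusMirrorsTiling` — [Balaban1983RegularityDecay] (2.42) p. 584, the multiple reflection method on the doubled torus: THE IMAGES OF THE OPEN
# MIRROR BOX TILE THE FREE SITES, the reflection group `(ℤ/2)^{#mir}` as an index product (`xor`, multiplicative signs), and THE MIRROR CANCELLATION at every
# non-image site for any jointly reflection-invariant rectangular kernel — the SITE-CARRIER hypotheses of the fold engine `B4Eq242SignedImagesFold.sum_foldK_mul_foldK`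
# (ROAD (I) «IMAGES», file D1″; towards [Balaban1985BackgroundPropagators] Thm 3.2 (3.48) for the Dirichlet `C_□(1)` of the cube sequence, p. 409 l. 1–5)

statement-level skeleton of published theorems with citation tags; proofs where landed; nothing here is a claim about the Yang–Mills mass gap

CITATION HEADER (lean-in-tree rule).  [B4] = T. Bałaban, *Regularity and decay of lattice Green's functions*, Commun. Math. Phys. **89** (1983) 571–597
[`Balaban1983RegularityDecay`], (2.42) p. 584 (the multiple reflection representation; «Using this representation it is enough to prove (2.35), (2.36) for the propagator
G_j»).  [B9] = T. Bałaban, *Propagators for lattice gauge theories in a background field*, Commun. Math. Phys. **99** (1985) 389–434 [`Balaban1985BackgroundPropagators`],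
p. 394 («Dirichlet boundary conditions on Ω₀»), Thm 3.2 (3.48) p. 398, p. 409 l. 1–5 (`C_□(U)`).  [4] = [`Balaban1984PropagatorsII`] (2.1)–(2.4) p. 224.

WHY THIS FILE (cell `pub-ymgap`, node N06, seat dag-n06-c g33; FILE 5a `B4Eq242SignedImagesFold` is the abstract engine).  The fold engine's product formula over a middle
carrier asks for: (closure) an index product under which the admissible multi-indices, the reflections and the signs are multiplicative; (tiling) the images
`σ_ε z`, `ε` admissible, `z` in the interior, pairwise distinct; (cancellation) at every point NOT of that form, the signed image sum of the rows of a jointly invariant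
kernel vanishes.  For the SITE carrier of g31's doubled torus (D2 `B4Eq242TorusMirrors`: `trefl`, `tsign`, `mirIdx`, `tfold`, open ∕ closed mirror boxes) all three are
elementary and are proved here once, for any target carrier `Y₃` with its own action `σ₃` (sites again, or the blocks of the reflected family in the next file): every
site is an image of its fold (`exists_trefl_tfold`), two images of interior sites coincide only trivially (`trefl_injOn_open`, from D2's freeness), a non-image site
folds onto a mirror and is therefore FIXED by a single face reflection (`exists_single_fixed_of_not_image`), and at a fixed site the image sum cancels in pairs
`ε ↔ flip_μ ε` (`sum_tsign_mul_eq_zero_of_fixed`, D1 §2's pattern for rectangular kernels).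

WHAT IS PROVED (1 `def` with body — `xorIdx`; theorems; 0 sorry; 0 new named facts; standard axioms):
* §1 `xorIdx`, `xorIdx_mem_mirIdx`, `trefl_xorIdx` (= D2 `trefl_mul`), ★`tsign_xorIdx` (signs multiply), `xorIdx_self`, `xorIdx_xorIdx_cancel`, `xorIdx_comm`,
  `xorIdx_bot`, `xorIdx_eq_bot_iff`, ★`xorIdx_bijOn`, `flipAt_eq_xorIdx`, `trefl_trefl` (involution), `trefl_comm`;
* §2 `eq_mfold_or_eq_mref_mfold` (one coordinate), ★`exists_trefl_tfold`, ★`trefl_injOn_open` (TILING), ★`exists_single_fixed_of_not_image`;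
* §3 ★`sum_tsign_mul_eq_zero_of_fixed` (rectangular cancellation at a fixed site), ★★`site_cancel` (CANCELLATION off the image, packaged in the engine's shape),
  ★★`site_tiling` (TILING in the engine's shape), `site_closure` (the closure data in the engine's shape for `σ₂ = σ₃ = trefl`).

HONEST SCOPE / NOT CLAIMED.  Elementary lattice geometry on D2's doubled torus; no operator, no estimate; the BLOCK carrier (reflections of the blocks of the reflected family,
their tiling and cancellation) and the instance for `C_□(1)` are the next file's.  Count-neutral; N06 NOT discharged; nothing on `d = 4`, the continuum, reflection
positivity, the mass gap or Clay.  No `sorry`, no `axiom`, no `instance`, no `notation`.  Seat `pub-ymgap-dag-n06-c` g33, 2026-08-31; `--supports stmt-QuantumFields-27239`.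

RELATED IN THE TREE, NOT DUPLICATED: D2 `B4Eq242TorusMirrors` (all one-coordinate facts, `trefl_mul`, `trefl_not_mem_open`, `tsign_flipAt`, `tfold_*` — USED), D1
`B4Eq242SignedImages.sum_sign_mul_apply_perm_eq_zero` (square cancellation; §3 is its rectangular twin), g31's `B6MultiLevelTorusMirrorImageFold` §1
(`exists_single_fixed_of_mem_closed_not_mem_open`, USED), FILE 5a `B4Eq242SignedImagesFold` (the engine these hypotheses feed).
-/

namespace Literature.MathematicalPhysics.QuantumFieldTheory.Balaban1983to89.B4Eq242TorusMirrorsTiling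

open Finset
open Literature.MathematicalPhysics.QuantumFieldTheory.Balaban1983to89.B4Reflection242 (boxDom mem_boxDom)
open Literature.MathematicalPhysics.QuantumFieldTheory.Balaban1983to89.B4Eq242TorusMirrors
open Literature.MathematicalPhysics.QuantumFieldTheory.Balaban1983to89.B6MultiLevelTorusMirrorImageFold (exists_single_fixed_of_mem_closed_not_mem_open)
open Literature.MathematicalPhysics.QuantumFieldTheory.Balaban1983to89.B6MultiLevelTorusMirrorCompression (mirBoxOpen_subset_closed)

variable {d : ℕ}

/-! ## §1  The reflection group `(ℤ/2)^{#mir}` as an index product -/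

section Group

/-- the index product: pointwise `xor` of multi-indices (`σ_{ε ⊻ ε′} = σ_ε σ_{ε′}`). [cite: Balaban1983RegularityDecay, (2.42) p.584 («+ …»: the group generated by the face reflections), dictionary] -/
def xorIdx (ε ε' : Fin (d + 1) → Bool) : Fin (d + 1) → Bool := fun μ => xor (ε μ) (ε' μ)

variable {mir : Fin (d + 1) → Bool}

/-- admissible multi-indices are closed under the product. [cite: Balaban1983RegularityDecay, (2.42) p.584, bookkeeping] -/
theorem xorIdx_mem_mirIdx {ε ε' : Fin (d + 1) → Bool} (hε : ε ∈ mirIdx mir) (hε' : ε' ∈ mirIdx mir) : xorIdx ε ε' ∈ mirIdx mir := by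
  rw [mirIdx, Finset.mem_filter] at hε hε' ⊢
  refine ⟨Finset.mem_univ _, fun μ hμ => ?_⟩
  unfold xorIdx at hμ
  cases h1 : ε μ <;> cases h2 : ε' μ <;> simp_all

/-- `ε ⊻ ε = ⊥`. [cite: Balaban1983RegularityDecay, (2.42) p.584, bookkeeping] -/
theorem xorIdx_self (ε : Fin (d + 1) → Bool) : xorIdx ε ε = fun _ => false := by
  funext μ; unfold xorIdx; simp

/-- `⊻` is involutive in the second slot: `ε ⊻ (ε ⊻ ε′) = ε′`. [cite: Balaban1983RegularityDecay, (2.42) p.584, bookkeeping] -/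
theorem xorIdx_xorIdx_cancel (ε ε' : Fin (d + 1) → Bool) : xorIdx ε (xorIdx ε ε') = ε' := by
  funext μ; unfold xorIdx; cases ε μ <;> cases ε' μ <;> rfl

/-- `⊻` is commutative. [cite: Balaban1983RegularityDecay, (2.42) p.584, bookkeeping] -/
theorem xorIdx_comm (ε ε' : Fin (d + 1) → Bool) : xorIdx ε ε' = xorIdx ε' ε := by
  funext μ; unfold xorIdx; cases ε μ <;> cases ε' μ <;> rfl

/-- `ε ⊻ ⊥ = ε`. [cite: Balaban1983RegularityDecay, (2.42) p.584, bookkeeping] -/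
theorem xorIdx_bot (ε : Fin (d + 1) → Bool) : xorIdx ε (fun _ => false) = ε := by
  funext μ; unfold xorIdx; cases ε μ <;> rfl

/-- `ε ⊻ ε′ = ⊥ ↔ ε = ε′`. [cite: Balaban1983RegularityDecay, (2.42) p.584, bookkeeping] -/
theorem xorIdx_eq_bot_iff (ε ε' : Fin (d + 1) → Bool) : (xorIdx ε ε' = fun _ => false) ↔ ε = ε' := by
  constructor
  · intro h
    funext μ
    have hμ := congrFun h μ
    unfold xorIdx at hμ
    cases h1 : ε μ <;> cases h2 : ε' μ <;> simp_all
  · rintro rfl; exact xorIdx_self ε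

/-- ★ left multiplication by an admissible multi-index is a bijection of the admissible multi-indices (the hypothesis `hbij` of the fold engine).
[cite: Balaban1983RegularityDecay, (2.42) p.584, bookkeeping] -/
theorem xorIdx_bijOn {ε : Fin (d + 1) → Bool} (hε : ε ∈ mirIdx mir) : Set.BijOn (xorIdx ε) ↑(mirIdx mir) ↑(mirIdx mir) := by
  have hmaps : Set.MapsTo (xorIdx ε) ↑(mirIdx mir) ↑(mirIdx mir) := fun ε' hε' => by
    rw [Finset.mem_coe] at hε' ⊢; exact xorIdx_mem_mirIdx hε hε'
  refine Set.InvOn.bijOn (f' := xorIdx ε) ⟨fun ε' _ => xorIdx_xorIdx_cancel ε ε', fun ε' _ => xorIdx_xorIdx_cancel ε ε'⟩ hmaps hmaps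

/-- `flip_μ ε = δ_μ ⊻ ε`. [cite: Balaban1983RegularityDecay, (2.42) p.584, bookkeeping] -/
theorem flipAt_eq_xorIdx (μ : Fin (d + 1)) (ε : Fin (d + 1) → Bool) : flipAt μ ε = xorIdx (single μ) ε := flipAt_eq_xor μ ε

/-- ★ the signs are multiplicative under the product. [cite: Balaban1983RegularityDecay, (2.42) p.584 (odd images carry the sign); Balaban1985BackgroundPropagators, p.394] -/
theorem tsign_xorIdx {R : Type*} [CommRing R] (ε ε' : Fin (d + 1) → Bool) : tsign R mir (xorIdx ε ε') = tsign R mir ε * tsign R mir ε' := by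
  unfold tsign
  rw [← Finset.prod_mul_distrib]
  refine Finset.prod_congr rfl fun μ _ => ?_
  unfold xorIdx
  cases ε μ <;> cases ε' μ <;> cases mir μ <;> simp

variable {N : Fin (d + 1) → ℕ} {n h : Fin (d + 1) → ℤ}
  {hmir : ∀ μ, mir μ = true → (N μ : ℤ) = 2 * n μ ∧ 0 ≤ h μ ∧ h μ < n μ ∧ 2 ≤ n μ}

/-- the reflections are multiplicative under the product (D2 `trefl_mul`). [cite: Balaban1983RegularityDecay, (2.42) p.584] -/
theorem trefl_xorIdx (ε ε' : Fin (d + 1) → Bool) : trefl hmir (xorIdx ε ε') = trefl hmir ε * trefl hmir ε' := by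
  rw [trefl_mul]; rfl

/-- every face reflection is an involution. [cite: Balaban1983RegularityDecay, (2.42) p.584, bookkeeping] -/
theorem trefl_trefl (ε : Fin (d + 1) → Bool) (x : ↥(boxDom N)) : trefl hmir ε (trefl hmir ε x) = x := by
  rw [← Equiv.Perm.mul_apply, trefl_mul, show (fun μ => xor (ε μ) (ε μ)) = xorIdx ε ε from rfl, xorIdx_self, trefl_bot, Equiv.Perm.one_apply]

/-- the face reflections commute. [cite: Balaban1983RegularityDecay, (2.42) p.584, bookkeeping] -/
theorem trefl_comm (ε ε' : Fin (d + 1) → Bool) : trefl hmir ε * trefl hmir ε' = trefl hmir ε' * trefl hmir ε := by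
  rw [← trefl_xorIdx, ← trefl_xorIdx, xorIdx_comm]

end Group

/-! ## §2  The tiling of the doubled torus by the images of the open mirror box -/

section Tiling

variable {N : Fin (d + 1) → ℕ} {mir : Fin (d + 1) → Bool} {n h : Fin (d + 1) → ℤ}
  {hmir : ∀ μ, mir μ = true → (N μ : ℤ) = 2 * n μ ∧ 0 ≤ h μ ∧ h μ < n μ ∧ 2 ≤ n μ}

/-- one coordinate: every site of `[0, 2n)` is its fold or the reflection of its fold. [cite: Balaban1983RegularityDecay, (2.42) p.584, bookkeeping] -/
theorem eq_mfold_or_eq_mref_mfold {nμ hμ t : ℤ} (ht : 0 ≤ t) (htN : t < 2 * nμ) :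
    (hμ ≤ t ∧ t ≤ hμ + nμ ∧ mfold nμ hμ t = t) ∨ (¬ (hμ ≤ t ∧ t ≤ hμ + nμ) ∧ mref nμ hμ (mfold nμ hμ t) = t) := by
  unfold mfold mref; split_ifs <;> omega

/-- ★ **EVERY SITE IS AN IMAGE OF ITS FOLD**: `y = σ_ε (fold y)` for an admissible `ε` (flip exactly the mirrored coordinates lying off the closed segment).
[cite: Balaban1983RegularityDecay, (2.42) p.584 (the images exhaust the lattice)] -/
theorem exists_trefl_tfold (y : ↥(boxDom N)) : ∃ ε ∈ mirIdx mir, trefl hmir ε (tfold hmir y) = y := by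
  classical
  refine ⟨fun μ => mir μ && !decide (h μ ≤ y.1 μ ∧ y.1 μ ≤ h μ + n μ), ?_, ?_⟩
  · rw [mirIdx, Finset.mem_filter]
    refine ⟨Finset.mem_univ _, fun μ hμ => ?_⟩
    rw [Bool.and_eq_true] at hμ; exact hμ.1
  · refine Subtype.ext (funext fun μ => ?_)
    rw [trefl_apply_val, tfold_apply_val]
    by_cases hm : mir μ = true
    · obtain ⟨hNμ, h0, hn, -⟩ := hmir μ hm
      have hy := (mem_boxDom.1 y.2) μ
      rcases eq_mfold_or_eq_mref_mfold (hμ := h μ) hy.1 (by rw [← hNμ]; exact hy.2) with ⟨h1, h2, h3⟩ | ⟨h1, h3⟩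
      · simp [hm, h1, h2, h3]
      · simp [hm, h1, h3]
    · have hm' : mir μ = false := by simpa using hm
      simp [hm']

/-- ★ **TILING**: two admissible images of sites of the OPEN mirror box coincide only trivially (D2's freeness `trefl_not_mem_open` + the group law).
[cite: Balaban1983RegularityDecay, (2.42) p.584 (the images are distinct)] -/
theorem trefl_injOn_open {ε ε' : Fin (d + 1) → Bool} (hε : ε ∈ mirIdx mir) (hε' : ε' ∈ mirIdx mir) {x x' : ↥(boxDom N)}
    (hx : x ∈ mirBoxOpen N mir n h) (hx' : x' ∈ mirBoxOpen N mir n h) (he : trefl hmir ε x = trefl hmir ε' x') : ε = ε' ∧ x = x' := by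
  -- `x = σ_{ε ⊻ ε′} x′`
  have hxx : x = trefl hmir (xorIdx ε ε') x' := by
    have h1 : trefl hmir ε (trefl hmir ε x) = trefl hmir ε (trefl hmir ε' x') := by rw [he]
    rw [trefl_trefl, ← Equiv.Perm.mul_apply, ← trefl_xorIdx] at h1
    exact h1
  by_cases hb : xorIdx ε ε' = fun _ => false
  · have hεε : ε = ε' := (xorIdx_eq_bot_iff ε ε').1 hb
    refine ⟨hεε, ?_⟩
    rw [hxx, hb, trefl_bot, Equiv.Perm.one_apply]
  · exact absurd (hxx ▸ hx) (trefl_not_mem_open hmir (xorIdx_mem_mirIdx hε hε') hb hx')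

/-- ★ **A NON-IMAGE SITE IS A MIRROR SITE**: a site which is not an admissible image of a site of the open mirror box is fixed by a single mirrored face reflection
(its fold lies on the closed box but not in the open one). [cite: Balaban1983RegularityDecay, (2.42) p.584; Balaban1985BackgroundPropagators, p.394 (∂Ω₀)] -/
theorem exists_single_fixed_of_not_image {w : ↥(boxDom N)}
    (hw : ¬ ∃ ε ∈ mirIdx mir, ∃ x ∈ mirBoxOpen N mir n h, trefl hmir ε x = w) :
    ∃ μ, mir μ = true ∧ trefl hmir (single μ) w = w := by
  obtain ⟨ε, hε, hεw⟩ := exists_trefl_tfold (hmir := hmir) w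
  have hclosed := tfold_mem_closed hmir w
  have hopen : tfold hmir w ∉ mirBoxOpen N mir n h := fun ho => hw ⟨ε, hε, tfold hmir w, ho, hεw⟩
  obtain ⟨μ, hm, hfix⟩ := exists_single_fixed_of_mem_closed_not_mem_open (hmir := hmir) hclosed hopen
  refine ⟨μ, hm, ?_⟩
  conv_lhs => rw [← hεw]
  rw [← Equiv.Perm.mul_apply, trefl_comm, Equiv.Perm.mul_apply, hfix, hεw]

end Tiling

/-! ## §3  The mirror cancellation for jointly invariant rectangular kernels; the engine's site-carrier hypotheses packaged -/

section Cancel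

variable {N : Fin (d + 1) → ℕ} {mir : Fin (d + 1) → Bool} {n h : Fin (d + 1) → ℤ}
  {hmir : ∀ μ, mir μ = true → (N μ : ℤ) = 2 * n μ ∧ 0 ≤ h μ ∧ h μ < n μ ∧ 2 ≤ n μ}
variable {R : Type*} [CommRing R] {Y₃ : Type*}

/-- ★ **THE MIRROR CANCELLATION AT A FIXED SITE (rectangular)**: for a kernel `N : sites × Y₃` jointly invariant under the `μ`-th face reflection (acting on `Y₃` by
`σ₃(δ_μ)`, with `σ₃(flip_μ ε) = σ₃(δ_μ)σ₃(ε)`), at a site `w` fixed by that reflection the signed image sum of the row `N w ·` vanishes — the images pair off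
`ε ↔ flip_μ ε` with opposite signs. [cite: Balaban1983RegularityDecay, (2.42) p.584; Balaban1985BackgroundPropagators, p.394 (the Dirichlet rows vanish on ∂Ω₀)] -/
theorem sum_tsign_mul_eq_zero_of_fixed (σ₃ : (Fin (d + 1) → Bool) → Equiv.Perm Y₃) {μ : Fin (d + 1)} (hμ : mir μ = true)
    (hσ₃ : ∀ ε ∈ mirIdx mir, σ₃ (flipAt μ ε) = σ₃ (single μ) * σ₃ ε)
    (Nm : Matrix ↥(boxDom N) Y₃ R) (hN : ∀ u v, Nm (trefl hmir (single μ) u) (σ₃ (single μ) v) = Nm u v)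
    {w : ↥(boxDom N)} (hw : trefl hmir (single μ) w = w) (y : Y₃) :
    ∑ ε ∈ mirIdx mir, tsign R mir ε * Nm w (σ₃ ε y) = 0 := by
  refine Finset.sum_involution (fun ε _ => flipAt μ ε) ?_ ?_ ?_ ?_
  · intro ε hε
    have hval : Nm w (σ₃ (flipAt μ ε) y) = Nm w (σ₃ ε y) := by
      rw [hσ₃ ε hε, Equiv.Perm.mul_apply]
      conv_lhs => rw [← hw]
      exact hN w (σ₃ ε y)
    rw [tsign_flipAt hμ, hval, neg_mul, add_neg_cancel]
  · intro ε _ _ heq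
    have hc := congrFun heq μ
    unfold flipAt at hc
    rw [Function.update_self] at hc
    cases h' : ε μ <;> simp [h'] at hc
  · intro ε hε; exact flipAt_mem_mirIdx hμ hε
  · intro ε _; exact flipAt_flipAt μ ε

/-- ★★ **CANCELLATION OFF THE IMAGE, in the fold engine's shape**: for a kernel `N : sites × Y₃` jointly invariant under every mirrored face reflection, the signed image
sum of the row at any site which is NOT an admissible image of an open-box site vanishes (that site is a mirror site, §2).
[cite: Balaban1983RegularityDecay, (2.42) p.584; Balaban1985BackgroundPropagators, p.394] -/
theorem site_cancel (σ₃ : (Fin (d + 1) → Bool) → Equiv.Perm Y₃)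
    (hσ₃ : ∀ μ, mir μ = true → ∀ ε ∈ mirIdx mir, σ₃ (flipAt μ ε) = σ₃ (single μ) * σ₃ ε)
    (Nm : Matrix ↥(boxDom N) Y₃ R) (hN : ∀ μ, mir μ = true → ∀ u v, Nm (trefl hmir (single μ) u) (σ₃ (single μ) v) = Nm u v) :
    ∀ w : ↥(boxDom N), (¬ ∃ ε ∈ mirIdx mir, ∃ x ∈ mirBoxOpen N mir n h, trefl hmir ε x = w) →
      ∀ y : Y₃, ∑ ε ∈ mirIdx mir, tsign R mir ε * Nm w (σ₃ ε y) = 0 := by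
  intro w hw y
  obtain ⟨μ, hm, hfix⟩ := exists_single_fixed_of_not_image (hmir := hmir) hw
  exact sum_tsign_mul_eq_zero_of_fixed σ₃ hm (hσ₃ μ hm) Nm (hN μ hm) hfix y

/-- ★★ **TILING, in the fold engine's shape**. [cite: Balaban1983RegularityDecay, (2.42) p.584] -/
theorem site_tiling : ∀ ε ∈ mirIdx mir, ∀ ε' ∈ mirIdx mir, ∀ z ∈ mirBoxOpen N mir n h, ∀ z' ∈ mirBoxOpen N mir n h,
    trefl hmir ε z = trefl hmir ε' z' → ε = ε' ∧ z = z' :=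
  fun _ hε _ hε' _ hz _ hz' he => trefl_injOn_open hε hε' hz hz' he

/-- **CLOSURE, in the fold engine's shape** (for the site action on both sides): the product `⊻` stays admissible, the reflections and the signs are multiplicative, and
left multiplication is a bijection of the admissible multi-indices. [cite: Balaban1983RegularityDecay, (2.42) p.584, bookkeeping] -/
theorem site_closure :
    (∀ ε ∈ mirIdx mir, ∀ ε' ∈ mirIdx mir, xorIdx ε ε' ∈ mirIdx mir) ∧
    (∀ ε ∈ mirIdx mir, ∀ ε' ∈ mirIdx mir, trefl hmir (xorIdx ε ε') = trefl hmir ε * trefl hmir ε') ∧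
    (∀ ε ∈ mirIdx mir, ∀ ε' ∈ mirIdx mir, tsign R mir (xorIdx ε ε') = tsign R mir ε * tsign R mir ε') ∧
    (∀ ε ∈ mirIdx mir, Set.BijOn (xorIdx ε) ↑(mirIdx mir) ↑(mirIdx mir)) :=
  ⟨fun _ hε _ hε' => xorIdx_mem_mirIdx hε hε', fun ε _ ε' _ => trefl_xorIdx ε ε', fun ε _ ε' _ => tsign_xorIdx ε ε', fun _ hε => xorIdx_bijOn hε⟩

/-- the site action is compatible with the flips (the hypothesis `hσ₃` of `site_cancel` when `Y₃` = sites). [cite: Balaban1983RegularityDecay, (2.42) p.584, bookkeeping] -/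
theorem trefl_flipAt' : ∀ μ, mir μ = true → ∀ ε ∈ mirIdx mir, trefl hmir (flipAt μ ε) = trefl hmir (single μ) * trefl hmir ε :=
  fun μ _ ε _ => trefl_flipAt hmir μ ε

end Cancel

/-! ## §4 (v1.1)  Two more bookkeeping facts about the index product used by the block-level instance -/

section GroupMore

/-- `⊻` is associative. [cite: Balaban1983RegularityDecay, (2.42) p.584, bookkeeping] -/
theorem xorIdx_assoc (ε ε' ε'' : Fin (d + 1) → Bool) : xorIdx (xorIdx ε ε') ε'' = xorIdx ε (xorIdx ε' ε'') := by
  funext μ; unfold xorIdx; cases ε μ <;> cases ε' μ <;> cases ε'' μ <;> rfl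

/-- `⊥ ⊻ ε = ε`. [cite: Balaban1983RegularityDecay, (2.42) p.584, bookkeeping] -/
theorem bot_xorIdx (ε : Fin (d + 1) → Bool) : xorIdx (fun _ => false) ε = ε := by
  funext μ; unfold xorIdx; cases ε μ <;> rfl

end GroupMore

end Literature.MathematicalPhysics.QuantumFieldTheory.Balaban1983to89.B4Eq242TorusMirrorsTiling
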